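import Mathlib
import Summits.Ventures.HodgeRepro2.SexticGalois
import Summits.Ventures.HodgeRepro2.T5CyclicSubfields
import Summits.Ventures.HodgeRepro2.ReflexSignatureComplex
import Summits.Ventures.HodgeRepro2.ReflexComplex
import Summits.Ventures.HodgeRepro2.BallTransitive
import Summits.Ventures.HodgeRepro2.T6B2Defs
import Summits.Ventures.HodgeRepro2.T6B2Hyp
import Summits.Ventures.HodgeRepro2.T6B2Reflex
import Summits.Ventures.HodgeRepro2.T6B2Hodge

/-!
# T6B2Main — sub-goal B2 «the canonical model / reflex field»: the kernel statement `B2_main`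

TIER4 §B2 (owner p4, FINAL v8, PASS ×4) identifies the Shimura datum of the transfer, its reflex
field, its canonical model and the CM reflex fields of the four vertices. What of it the kernel can
carry (route/T6-B2-t6-p5.md §§0–1) is collected here for the sextic Galois CM field `K` of the
route (`[IsGalois ℚ K]`, `[NumberField.IsCMField K]`, `finrank ℚ K = 6`), a base embedding `τ₀`
(`τ_1` of TIER4) and a CM type `τ : Fin 3 → (K →+* ℂ)` (the vertices `T_i` of the parity tetrahedron
are seat p1's `parityTetrahedron K τ i`):
* (B2-ii) Liu Def. C.1 over `Gal(ℂ/ℚ)`: both reflex fields of the `ϑ_1`-nearby datum (signature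
  `(2,1), (3,0), (3,0)`, `n = 3`) are `τ₀(K)` — seat p4's `reflexFieldOfSig_eq_fieldRange_of_isGalois`;
* (B2-vi) the CM reflex fields `M_{T_i}` (Liu Def. 4.3(2) = Shimura's `K*`, as `complexTraceField`):
  `τ₀(K)` at every primitive vertex, a quadratic subfield of `τ₀(K)` at the non-primitive one, and
  exactly one vertex is non-primitive (seat p1's `card_nonPrimitive_parityTetrahedron`) — TIER4
  §B2.7(b) («M_{μ_i} = F_1 for the three primitive vertices and M_{μ_4} = F_{0,1}», the imaginary
  quadratic subfield);
* (B2-i) the Hodge map at the nearby signature is `(diag(1,1,z/z̄), I_3, I_3)` and the conjugate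
  datum (`T6B2Hodge`);
* (B2-iii) the ball model of the conjugacy class: every negative line of `diag(1,1,−1)` on `ℂ³` is
  `g·ℂe_3` for some `g ∈ U(2,1)`, and carries a unique point of `𝔹²` (seat p4's `BallTransitive` /
  `BallLines`).
`B2_main` consumes NO display: the three displays of `T6B2Hyp` are discharged in `T6B2Reflex`.
NOT here (no kernel carrier; route/T6-B2-t6-p5.md §2 rows G1–G7): the Shimura datum and variety,
the canonical model, Liu Prop. C.5 / Rem. C.7, Moonen, Gross, Deligne — Layer III of the lead.
-/

namespace Summit.Ventures.HodgeRepro2.T6.B2Main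

open Summit.Ventures.HodgeRepro2 T6.B2Defs T6.B2Reflex T6.B2Hodge
open scoped Summit.Ventures.HodgeRepro2.ReflexSignature

variable {K : Type*} [Field K]

/-- A vertex of the parity tetrahedron is a finite set of embeddings (the range of a map on
`Fin 3`). -/
theorem finite_parityTetrahedron (τ : Fin 3 → K →+* ℂ) (i : Fin 4) :
    (parityTetrahedron K τ i).Finite :=
  Set.finite_range _

/-- The vertex `T_i` of the parity tetrahedron as a finset of embeddings (the argument of
`complexTraceField`). -/
noncomputable def vertexFinset (τ : Fin 3 → K →+* ℂ) (i : Fin 4) : Finset (K →+* ℂ) :=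
  (finite_parityTetrahedron τ i).toFinset

/-- Unfolding lemma: the vertex finset is the vertex set. -/
theorem coe_vertexFinset (τ : Fin 3 → K →+* ℂ) (i : Fin 4) :
    (vertexFinset τ i : Set (K →+* ℂ)) = parityTetrahedron K τ i :=
  Set.Finite.coe_toFinset _

section Galois

variable [NumberField K] [IsGalois ℚ K]

/-- (B2-vi), primitive vertices — TIER4 §B2.7(b) / Shimura §8.4 Ex. (1): the CM reflex field of a
primitive vertex of the parity tetrahedron is `τ₀(K)` itself. -/
theorem complexTraceField_vertex_of_isPrimitiveOn (τ₀ : K →+* ℂ) (τ : Fin 3 → K →+* ℂ) (i : Fin 4)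
    (h : IsPrimitiveOn (galEmb K τ₀ ⁻¹' parityTetrahedron K τ i)) :
    complexTraceField (vertexFinset τ i) = τ₀.toRatAlgHom.fieldRange := by
  classical
  rw [← image_galEmb_map_symm τ₀ (vertexFinset τ i)]
  apply complexTraceField_eq_fieldRange_of_isPrimitiveOn
  rw [coe_map_symm_galEmb, coe_vertexFinset]
  exact h

/-- Every CM reflex field `M_{T_i}` lies in `τ₀(K)` (`K` being Galois, every trace
`Σ_{φ∈T_i} φ ξ` is a sum of elements of `τ₀(K)`). -/
theorem complexTraceField_le_fieldRange (τ₀ : K →+* ℂ) (Φ : Finset (K →+* ℂ)) :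
    complexTraceField Φ ≤ τ₀.toRatAlgHom.fieldRange := by
  classical
  rw [← image_galEmb_map_symm τ₀ Φ, ← map_traceField]
  exact IntermediateField.map_mono _ le_top |>.trans (AlgHom.fieldRange_eq_map τ₀.toRatAlgHom).ge

/-- (B2-vi), the non-primitive vertex — TIER4 §B2.7(b): for a sextic Galois CM field the CM reflex
field of a non-primitive vertex of the parity tetrahedron is a quadratic subfield of `τ₀(K)`
(`M_{μ_4} = F_{0,1}`, the imaginary quadratic subfield of `F_1`), from seat p1's
`finrank_reflexFieldOf_eq_two_of_not_isPrimitiveOn` transported to `ℂ`. -/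
theorem finrank_complexTraceField_vertex_of_not_isPrimitiveOn [NumberField.IsCMField K]
    (h6 : Module.finrank ℚ K = 6) (τ₀ : K →+* ℂ) (τ : Fin 3 → K →+* ℂ)
    (hinj : Function.Injective τ) (hτ : IsCMType K (Set.range τ)) (i : Fin 4)
    (h : ¬ IsPrimitiveOn (galEmb K τ₀ ⁻¹' parityTetrahedron K τ i)) :
    Module.finrank ℚ (complexTraceField (vertexFinset τ i)) = 2 := by
  classical
  haveI : IsMulCommutative (K ≃ₐ[ℚ] K) := isMulCommutative_gal_of_finrank_six K h6
  have hcm : IsCMType K (parityTetrahedron K τ i) :=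
    (isWeilFace_parityTetrahedron K τ hinj hτ).1 i
  rw [← image_galEmb_map_symm τ₀ (vertexFinset τ i), finrank_complexTraceField,
    traceField_eq_reflexFieldOf τ₀]
  have himg : (⇑(galEmb K τ₀) '' ((vertexFinset τ i).map (galEmb K τ₀).symm.toEmbedding :
      Set (K ≃ₐ[ℚ] K))) = parityTetrahedron K τ i := by
    rw [coe_map_symm_galEmb, coe_vertexFinset, Set.image_preimage_eq _ (galEmb K τ₀).surjective]
  rw [himg]
  exact finrank_reflexFieldOf_eq_two_of_not_isPrimitiveOn K h6 τ₀ hcm h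

/-- (B2-vi), the non-primitive vertex, sharpened — TIER4 §B2.7(b) «M_{μ_4} = F_{0,1} := τ_1(F_0)», the
image of THE imaginary quadratic subfield `F₀` of `K`: `K/ℚ` being cyclic of degree 6 (seat p1's
`isCyclic_gal_of_finrank_six`), `K` has exactly one quadratic subfield (seat p3's
`T5CyclicSubfields.IntermediateField.eq_of_finrank_eq_of_isCyclic`), and the CM reflex field of the
non-primitive vertex is its image under `τ₀`. -/
theorem complexTraceField_vertex_of_not_isPrimitiveOn [NumberField.IsCMField K]
    (h6 : Module.finrank ℚ K = 6) (τ₀ : K →+* ℂ) (τ : Fin 3 → K →+* ℂ)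
    (hinj : Function.Injective τ) (hτ : IsCMType K (Set.range τ)) (i : Fin 4)
    (h : ¬ IsPrimitiveOn (galEmb K τ₀ ⁻¹' parityTetrahedron K τ i))
    (F₀ : IntermediateField ℚ K) (hF₀ : Module.finrank ℚ F₀ = 2) :
    complexTraceField (vertexFinset τ i) = F₀.map τ₀.toRatAlgHom := by
  classical
  haveI : IsCyclic (K ≃ₐ[ℚ] K) := isCyclic_gal_of_finrank_six K h6
  have h2 := finrank_complexTraceField_vertex_of_not_isPrimitiveOn h6 τ₀ τ hinj hτ i h
  rw [← image_galEmb_map_symm τ₀ (vertexFinset τ i)] at h2 ⊢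
  rw [finrank_complexTraceField] at h2
  rw [← map_traceField]
  congr 1
  exact T5CyclicSubfields.IntermediateField.eq_of_finrank_eq_of_isCyclic (h2.trans hF₀.symm)

end Galois

open Classical in
/-- **B2_main** — sub-goal B2 in kernel, for the sextic Galois CM field `K` of the route, the base
embedding `τ₀` (`τ_1` of TIER4), a CM type `τ` (the parity tetrahedron's coordinates), any CM type
`Φ ∋ τ₀` of `K →ₐ[ℚ] ℂ` with `τ₀bar` its conjugate (Liu's `Φ^c ∩ π^{−1}ϑ_1`), and the nearby signature
`p = (2, 3, 3)` (so `q = (1, 0, 0)`, `n = 3`). Conjunction of: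
(a) (B2-ii) Liu Def. C.1 over `Gal(ℂ/ℚ)`: `E′_{V(ϑ_1),Φ} = E_{V(ϑ_1),Φ} = τ₀(K)`;
(b) (B2-vi) `M_{T_i} = τ₀(K)` at every primitive vertex, `[M_{T_i} : ℚ] = 2` with `M_{T_i} ⊂ τ₀(K)`
and `M_{T_i} = τ₀(F₀)` for every (= the unique) quadratic subfield `F₀` of `K` at every non-primitive
vertex, exactly one vertex is non-primitive, and the inverse types
`Φ_{μ_i} = T_i^{−1}` (Liu's CM types of the characters, TIER4 §B3(b)) are the same four vertices
(seat p1's `range_inverseType_parityTetrahedron`), so (b) covers the `M_{μ_i}` as well;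
(c) (B2-i) the Hodge tuple is `(diag(1,1,z/z̄), I_3, I_3)` and the conjugate datum holds at `ϑ_1`;
(d) (B2-iii) every negative line of `diag(1,1,−1)` on `ℂ³` is `g·ℂe_3` for some `g ∈ U(2,1)` and
carries a unique point of `𝔹²`.
No display is consumed (the three displays of `T6B2Hyp` are discharged in `T6B2Reflex`). -/
theorem B2_main (K : Type*) [Field K] [NumberField K] [NumberField.IsCMField K] [IsGalois ℚ K]
    (h6 : Module.finrank ℚ K = 6) (τ₀ : K →+* ℂ) (τ : Fin 3 → K →+* ℂ)
    (hinj : Function.Injective τ) (hτ : IsCMType K (Set.range τ))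
    (Φ : Set (K →ₐ[ℚ] ℂ)) [DecidablePred (· ∈ Φ)] (hΦ : τ₀.toRatAlgHom ∈ Φ) (τ₀bar : K →ₐ[ℚ] ℂ)
    (p : Fin 3 → ℕ) (hp0 : p 0 = 2) (hp1 : p 1 = 3) (hp2 : p 2 = 3) :
    (ReflexSignature.reflexFieldOfSig ℚ ℂ (ReflexSignature.reducedSig τ₀.toRatAlgHom) =
        τ₀.toRatAlgHom.fieldRange ∧
      ReflexSignature.reflexFieldOfSig ℚ ℂ (ReflexSignature.nearbyFullSig Φ τ₀.toRatAlgHom τ₀bar 3) =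
        τ₀.toRatAlgHom.fieldRange) ∧
    ((∀ i, IsPrimitiveOn (galEmb K τ₀ ⁻¹' parityTetrahedron K τ i) →
        complexTraceField (vertexFinset τ i) = τ₀.toRatAlgHom.fieldRange) ∧
      (∀ i, ¬ IsPrimitiveOn (galEmb K τ₀ ⁻¹' parityTetrahedron K τ i) →
        Module.finrank ℚ (complexTraceField (vertexFinset τ i)) = 2 ∧
          complexTraceField (vertexFinset τ i) ≤ τ₀.toRatAlgHom.fieldRange ∧
          ∀ F₀ : IntermediateField ℚ K, Module.finrank ℚ F₀ = 2 →
            complexTraceField (vertexFinset τ i) = F₀.map τ₀.toRatAlgHom) ∧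
      (Finset.univ.filter fun i : Fin 4 =>
        ¬ IsPrimitiveOn (galEmb K τ₀ ⁻¹' parityTetrahedron K τ i)).card = 1 ∧
      (Set.range fun i => inverseType K τ₀ (parityTetrahedron K τ i)) =
        Set.range (parityTetrahedron K τ)) ∧
    (∀ z : ℂ, liuHodgeTuple 3 p z 0 = BallGroup.hodge z ∧ liuHodgeTuple 3 p z 1 = 1 ∧
      liuHodgeTuple 3 p z 2 = 1 ∧
      (liuHodgeTuple 3 p z 0).map star = liuHodgeTuple 3 p (star z) 0) ∧
    (∀ v : Fin 3 → ℂ, BallLines.hermForm21 v < 0 →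
      (∃ g, BallGroup.IsU21 g ∧ ∃ c : ℂ, c ≠ 0 ∧ g.mulVec BallGroup.e₃ = c • v) ∧
        ∃! z, z ∈ BallLines.ball₂ ∧ v = v 2 • BallLines.homog z) := by
  refine ⟨?_, ⟨?_, ?_, ?_, ?_⟩, ?_, ?_⟩
  · exact ReflexSignatureComplex.reflexFieldOfSig_eq_fieldRange_of_isGalois Φ τ₀.toRatAlgHom τ₀bar 3
      hΦ (by norm_num) (by norm_num)
  · intro i hi
    exact complexTraceField_vertex_of_isPrimitiveOn τ₀ τ i hi
  · intro i hi
    exact ⟨finrank_complexTraceField_vertex_of_not_isPrimitiveOn h6 τ₀ τ hinj hτ i hi,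
      complexTraceField_le_fieldRange τ₀ _,
      fun F₀ hF₀ => complexTraceField_vertex_of_not_isPrimitiveOn h6 τ₀ τ hinj hτ i hi F₀ hF₀⟩
  · exact card_nonPrimitive_parityTetrahedron K h6 τ₀ τ hτ
  · exact range_inverseType_parityTetrahedron K h6 τ₀ τ hτ
  · intro z
    exact ⟨liuHodgeTuple_nearby p z 0 hp0, liuHodgeTuple_eq_one p z 1 hp1,
      liuHodgeTuple_eq_one p z 2 hp2, map_star_liuHodgeTuple 3 p z 0⟩
  · intro v hv
    exact ⟨BallTransitive.exists_isU21_smul_mulVec_single v hv,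
      BallLines.exists_unique_ball_point v hv⟩

end Summit.Ventures.HodgeRepro2.T6.B2Main
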